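import Mathlib.Combinatorics.Pigeonhole
import Mathlib.Data.Finset.Sym
import Mathlib.Data.Fintype.BigOperators
import Mathlib.Data.Fintype.Pi
import Mathlib.Data.Nat.Choose.Basic
import Mathlib.Data.Sym.Sym2
import Mathlib.Tactic.Ring
import HarnessLib

/-!
# Counting colourings and cliques (Jukna 2012, §9.8, proof of Theorem 9.26)

Pure combinatorics behind the two cases of the lower-bounds criterion (Jukna 2012, Thm 9.17 /
9.18) applied to clique-like functions (Jukna 2012, §9.8, Theorem 9.26, Cases 1 and 2), in the
elementary form used for the proof of the Amano–Maruoka fact (`AmanoMaruoka.lean`; the proof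
file `AmanoMaruokaProofs.lean` is planned and builds on this one).
Vertices live in a finite type `α`, edges are unordered pairs `Sym2 α` (non-diagonal where
needed), colourings are maps `α → Fin c`. Everything in this file is PROVED.

* `card_filter_dependent_le` — colourings satisfying `h v = h (p v)` for `v` in a set `D` with
  `p(D) ∩ D = ∅` number at most `c ^ (card α - #D)` (they are determined off `D`).
* `exists_dependent_of_card` — **star or matching**: a set of at least `2 d²` non-loop edges
  contains `d` edges `{v, p v}` (`v ∈ D`) with `p(D) ∩ D = ∅` (a `d`-star if some vertex has
  degree `≥ d`, else a greedy `d`-matching-like system); this replaces the forest length measure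
  of Jukna's Theorem 9.26, Case 2 ("all vertices in each tree must receive the same colour").
* `card_filter_mono_le`, `exists_good_coloring` — hence at most `c ^ (card α - d)` colourings
  are monochromatic on such an edge set, and fewer than `c ^ d` such sets leave a colouring
  that is bichromatic on each of them (Jukna 2012, Thm 9.26, Case 2, union bound).
* `exists_mono_subset` — pigeonhole: a colour class contains `#V / c` vertices of `V`.
* `card_filter_supset_powersetCard_le` (from Mathlib's `Finset.card_filter_powersetCard_subset`),
  `choose_sub_mul_pow_le` — `q`-subsets of `V` containing a fixed `v`-set number
  `(#V - v).choose (q - v) ≤ (#V).choose q / c ^ v` when `q c ≤ #V` (Jukna 2012, Thm 9.26,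
  Case 1: "only `(n-r choose b-r)` of `b`-cliques can contain one clique").
* `edgeVerts`, `le_card_edgeVerts` — an edge set with more than `(d choose 2)` edges touches at
  least `d` vertices; `exists_good_clique` — the union bound of Case 1: few monomials and few
  single edges leave a `q`-subset of `V` whose clique contains none of them.

## References

* S. Jukna, *Boolean Function Complexity: Advances and Frontiers*, Springer (2012), §9.4
  (Theorem 9.18, p. 260) and §9.8 (Theorem 9.26, pp. 269–271) [Jukna2012].
* K. Amano, A. Maruoka, *A superpolynomial lower bound for a circuit computing the clique
  function with at most (1/6) log log n negation gates*, SIAM J. Comput. 35 (2005) 201–216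
  [AmanoMaruoka2005].
-/

namespace Literature.Computability.Complexity

open Finset

variable {α : Type*} [DecidableEq α]

/-! ### Vertices of an edge set -/

/-- The vertices touched by a finite set of edges (the union of their `Sym2.toFinset`s).
[folklore] -/
def edgeVerts (P : Finset (Sym2 α)) : Finset α := P.biUnion Sym2.toFinset

/-- Membership in `edgeVerts`. [folklore] -/
theorem mem_edgeVerts {P : Finset (Sym2 α)} {v : α} : v ∈ edgeVerts P ↔ ∃ e ∈ P, v ∈ e := by
  simp [edgeVerts, Sym2.mem_toFinset]

/-- An edge set lies inside the pairs of its vertex set. [folklore] -/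
theorem subset_sym2_edgeVerts (P : Finset (Sym2 α)) : P ⊆ (edgeVerts P).sym2 := fun e he =>
  Finset.mem_sym2_iff.2 fun _ hv => mem_edgeVerts.2 ⟨e, he, hv⟩

/-- Hence `#P ≤ (#edgeVerts P + 1) choose 2`. [folklore] -/
theorem card_le_choose_card_edgeVerts (P : Finset (Sym2 α)) : #P ≤ (#(edgeVerts P) + 1).choose 2 := by
  rw [← Finset.card_sym2]
  exact Finset.card_le_card (subset_sym2_edgeVerts P)

/-- An edge set with more than `(d choose 2)` edges touches at least `d` vertices (Jukna 2012,
proof of Thm 9.26: `|S| ≤ (μ(S) choose 2)`). [cite: Jukna2012, Thm. 9.26] -/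
theorem le_card_edgeVerts {P : Finset (Sym2 α)} {d : ℕ} (hP : d.choose 2 < #P) : d ≤ #(edgeVerts P) := by
  by_contra hlt
  push Not at hlt
  have h1 := card_le_choose_card_edgeVerts P
  have h2 : (#(edgeVerts P) + 1).choose 2 ≤ d.choose 2 := Nat.choose_le_choose 2 hlt
  omega

/-- If every edge of `P` lies inside `Q`, so do its vertices. [folklore] -/
theorem edgeVerts_subset {P : Finset (Sym2 α)} {Q : Finset α} (h : ∀ e ∈ P, ∀ v ∈ e, v ∈ Q) :
    edgeVerts P ⊆ Q := fun v hv => by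
  obtain ⟨e, he, hve⟩ := mem_edgeVerts.1 hv
  exact h e he v hve

/-! ### Star or matching in a large edge set -/

/-- The neighbours of `u` along the (non-loop) edges of `S`. [folklore] -/
def edgeNbrs (S : Finset (Sym2 α)) (u : α) : Finset α :=
  (edgeVerts S).filter fun v => v ≠ u ∧ s(u, v) ∈ S

/-- Every edge of `S` through `y` comes from a neighbour of `y` (non-loop edges). [folklore] -/
theorem card_filter_mem_le_card_edgeNbrs (S : Finset (Sym2 α)) (hS : ∀ e ∈ S, ¬ e.IsDiag) (y : α) :
    #(S.filter fun e => y ∈ e) ≤ #(edgeNbrs S y) := by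
  refine Finset.card_le_card_of_surjOn (fun v => s(y, v)) fun e he => ?_
  simp only [Finset.coe_filter, Set.mem_setOf_eq] at he
  obtain ⟨heS, hye⟩ := he
  refine ⟨Sym2.Mem.other hye, ?_, Sym2.other_spec hye⟩
  simp only [edgeNbrs, Finset.coe_filter, Set.mem_setOf_eq, mem_edgeVerts]
  refine ⟨⟨e, heS, Sym2.other_mem hye⟩, Sym2.other_ne (hS e heS) hye, ?_⟩
  rw [Sym2.other_spec hye]
  exact heS

/-- **Star or matching.** A set `S` of at least `2 d²` non-loop edges contains a system of
`d` edges `{v, p v}`, `v ∈ D`, `#D ≥ d`, with `p(D) ∩ D = ∅`: a star at a vertex of degree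
`≥ d`, or else (all degrees `< d`) a greedily grown system, each new edge avoiding the `< 2d`
vertices used so far, which meet fewer than `2 d²` edges. (Elementary substitute for the
forest length measure in Jukna 2012, Thm 9.26, Case 2.) [folklore] -/
theorem exists_dependent_of_card (S : Finset (Sym2 α)) (hS : ∀ e ∈ S, ¬ e.IsDiag) (d : ℕ)
    (hd : 2 * d ^ 2 ≤ #S) :
    ∃ (D : Finset α) (p : α → α), d ≤ #D ∧ (∀ v ∈ D, p v ∉ D) ∧ ∀ v ∈ D, s(v, p v) ∈ S := by
  by_cases hdeg : ∃ u, d ≤ #(edgeNbrs S u)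
  · -- a star
    obtain ⟨u, hu⟩ := hdeg
    refine ⟨edgeNbrs S u, fun _ => u, hu, fun v hv => ?_, fun v hv => ?_⟩
    · simp [edgeNbrs]
    · simp only [edgeNbrs, Finset.mem_filter] at hv
      rw [Sym2.eq_swap]
      exact hv.2.2
  · -- all degrees are `< d`: grow the system greedily
    push Not at hdeg
    suffices ∀ j ≤ d, ∃ (D : Finset α) (p : α → α), #D = j ∧ (∀ v ∈ D, p v ∉ D) ∧
        ∀ v ∈ D, s(v, p v) ∈ S by
      obtain ⟨D, p, h1, h2, h3⟩ := this d le_rfl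
      exact ⟨D, p, h1.ge, h2, h3⟩
    intro j
    induction j with
    | zero => exact fun _ => ⟨∅, id, by simp, by simp, by simp⟩
    | succ j ih =>
      intro hj
      obtain ⟨D, p, hD, hp, hE⟩ := ih (Nat.le_of_succ_le hj)
      -- the vertices used so far and the edges meeting them
      set Y : Finset α := D ∪ D.image p with hY
      have hYcard : #Y ≤ 2 * j := by
        calc #Y ≤ #D + #(D.image p) := Finset.card_union_le _ _
          _ ≤ #D + #D := Nat.add_le_add_left Finset.card_image_le _
          _ = 2 * j := by rw [hD]; ring
      have hmeet : #(S.filter fun e => ∃ y ∈ Y, y ∈ e) < #S := by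
        have hsub : (S.filter fun e => ∃ y ∈ Y, y ∈ e) ⊆ Y.biUnion fun y => S.filter fun e => y ∈ e := by
          intro e he
          simp only [Finset.mem_filter] at he
          obtain ⟨heS, y, hy, hye⟩ := he
          exact Finset.mem_biUnion.2 ⟨y, hy, Finset.mem_filter.2 ⟨heS, hye⟩⟩
        have h1 : #(Y.biUnion fun y => S.filter fun e => y ∈ e) ≤ #Y * (d - 1) :=
          Finset.card_biUnion_le_card_mul _ _ _ fun y _ =>
            (card_filter_mem_le_card_edgeNbrs S hS y).trans (Nat.le_sub_one_of_lt (hdeg y))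
        have h2 : #Y * (d - 1) < 2 * d ^ 2 := by
          have hj' : j + 1 ≤ d := hj
          calc #Y * (d - 1) ≤ 2 * j * (d - 1) := Nat.mul_le_mul_right _ hYcard
            _ ≤ 2 * d * (d - 1) := Nat.mul_le_mul_right _ (Nat.mul_le_mul_left 2 (by omega))
            _ < 2 * d ^ 2 := by
              have : d - 1 < d := Nat.sub_one_lt (by omega)
              have hd0 : 0 < 2 * d := by omega
              calc 2 * d * (d - 1) < 2 * d * d := Nat.mul_lt_mul_of_pos_left this hd0
                _ = 2 * d ^ 2 := by ring
        exact ((Finset.card_le_card hsub).trans h1).trans_lt (h2.trans_le hd)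
      -- an edge avoiding `Y`
      obtain ⟨e, heS, heY⟩ := Finset.exists_mem_notMem_of_card_lt_card hmeet
      have heY' : ∀ y ∈ Y, y ∉ e := fun y hy hye =>
        heY (Finset.mem_filter.2 ⟨heS, y, hy, hye⟩)
      induction e using Sym2.ind with
      | _ x y' =>
        have hxy : x ≠ y' := fun h => hS _ heS (by simp [h])
        have hxY : x ∉ Y := fun h => heY' x h (Sym2.mem_mk_left x y')
        have hyY : y' ∉ Y := fun h => heY' y' h (Sym2.mem_mk_right x y')
        have hxD : x ∉ D := fun h => hxY (Finset.mem_union_left _ h)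
        have hyD : y' ∉ D := fun h => hyY (Finset.mem_union_left _ h)
        refine ⟨insert x D, fun v => if v = x then y' else p v, ?_, ?_, ?_⟩
        · rw [Finset.card_insert_of_notMem hxD, hD]
        · intro v hv
          rcases Finset.mem_insert.1 hv with rfl | hv
          · simp only [↓reduceIte, Finset.mem_insert, not_or]
            exact ⟨hxy.symm, hyD⟩
          · have hvx : v ≠ x := fun h => hxD (h ▸ hv)
            simp only [hvx, ↓reduceIte, Finset.mem_insert, not_or]
            refine ⟨fun h => hxY ?_, hp v hv⟩
            rw [← h]
            exact Finset.mem_union_right _ (Finset.mem_image_of_mem p hv)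
        · intro v hv
          rcases Finset.mem_insert.1 hv with rfl | hv
          · simpa using heS
          · have hvx : v ≠ x := fun h => hxD (h ▸ hv)
            simp only [hvx, ↓reduceIte]
            exact hE v hv

section Fintype

/-! Counting colourings `α → Fin c` of a finite vertex type. -/

variable [Fintype α]

/-! ### Colourings constrained along a dependent set -/

/-- Colourings `h : α → Fin c` with `h v = h (p v)` for all `v ∈ D`, where `p` maps `D` outside
`D`, are determined by their restriction to the complement of `D`; hence there are at most
`c ^ (card α - #D)` of them (Jukna 2012, proof of Thm 9.26, Case 2: "at most `a^{n-m}` ways to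
colour the remaining vertices"). [cite: Jukna2012, Thm. 9.26] -/
theorem card_filter_dependent_le (c : ℕ) (D : Finset α) (p : α → α) (hp : ∀ v ∈ D, p v ∉ D) :
    #((univ : Finset (α → Fin c)).filter fun h => ∀ v ∈ D, h v = h (p v)) ≤
      c ^ (Fintype.card α - #D) := by
  set T : Finset (α → Fin c) := univ.filter fun h => ∀ v ∈ D, h v = h (p v) with hT
  have key : #T ≤ #(univ : Finset (↥(Dᶜ : Finset α) → Fin c)) := by
    refine Finset.card_le_card_of_injOn (fun h (v : ↥(Dᶜ : Finset α)) => h v)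
      (fun _ _ => Finset.mem_coe.2 (Finset.mem_univ _)) ?_
    intro h₁ h₁T h₂ h₂T heq
    simp only [Finset.mem_coe, hT, Finset.mem_filter, Finset.mem_univ, true_and] at h₁T h₂T
    funext v
    by_cases hv : v ∈ D
    · have e := congrFun heq ⟨p v, Finset.mem_compl.2 (hp v hv)⟩
      simp only at e
      rw [h₁T v hv, h₂T v hv, e]
    · have e := congrFun heq ⟨v, Finset.mem_compl.2 hv⟩
      simpa using e
  refine key.trans ?_
  rw [Finset.card_univ, Fintype.card_fun, Fintype.card_fin, Fintype.card_coe, Finset.card_compl]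

/-! ### Monochromatic edge sets -/

/-- At most `c ^ (card α - d)` colourings with `c ≥ 1` colours make every edge of a set of
`≥ 2 d²` non-loop edges monochromatic (Jukna 2012, Thm 9.26, Case 2, with star-or-matching in
place of spanning forests). [cite: Jukna2012, Thm. 9.26] -/
theorem card_filter_mono_le {c : ℕ} (hc : 1 ≤ c) (d : ℕ) (S : Finset (Sym2 α))
    (hS : ∀ e ∈ S, ¬ e.IsDiag) (hd : 2 * d ^ 2 ≤ #S) :
    #((univ : Finset (α → Fin c)).filter fun h => ∀ e ∈ S, (e.map h).IsDiag) ≤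
      c ^ (Fintype.card α - d) := by
  obtain ⟨D, p, hdD, hp, hE⟩ := exists_dependent_of_card S hS d hd
  calc #((univ : Finset (α → Fin c)).filter fun h => ∀ e ∈ S, (e.map h).IsDiag)
      ≤ #((univ : Finset (α → Fin c)).filter fun h => ∀ v ∈ D, h v = h (p v)) := by
        refine Finset.card_le_card fun h hh => ?_
        simp only [Finset.mem_filter, Finset.mem_univ, true_and] at hh ⊢
        intro v hv
        have := hh _ (hE v hv)
        simpa [Sym2.map_mk] using this
    _ ≤ c ^ (Fintype.card α - #D) := card_filter_dependent_le c D p hp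
    _ ≤ c ^ (Fintype.card α - d) := Nat.pow_le_pow_right hc (Nat.sub_le_sub_left hdD _)

/-- Such a system of `d` edges needs `d` vertices in `D ⊆ univ`, so `d ≤ card α`. [folklore] -/
theorem le_card_of_two_mul_sq_le (d : ℕ) (S : Finset (Sym2 α)) (hS : ∀ e ∈ S, ¬ e.IsDiag)
    (hd : 2 * d ^ 2 ≤ #S) : d ≤ Fintype.card α := by
  obtain ⟨D, p, hdD, -, -⟩ := exists_dependent_of_card S hS d hd
  exact hdD.trans (Finset.card_le_univ D)

/-- **A good colouring exists** (Jukna 2012, Thm 9.26, Case 2, union bound): if a family of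
fewer than `c ^ d` edge sets, each with at least `2 d²` non-loop edges, is given, some colouring
with `c ≥ 1` colours is bichromatic on at least one edge of every member.
[cite: Jukna2012, Thm. 9.26] -/
theorem exists_good_coloring {c : ℕ} (hc : 1 ≤ c) (d : ℕ) (𝒮 : Finset (Finset (Sym2 α)))
    (h𝒮 : ∀ S ∈ 𝒮, (∀ e ∈ S, ¬ e.IsDiag) ∧ 2 * d ^ 2 ≤ #S) (hcard : #𝒮 < c ^ d) :
    ∃ h : α → Fin c, ∀ S ∈ 𝒮, ∃ e ∈ S, ¬ (e.map h).IsDiag := by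
  have : NeZero c := ⟨by omega⟩
  rcases 𝒮.eq_empty_or_nonempty with rfl | ⟨S₀, hS₀⟩
  · exact ⟨fun _ => 0, by simp⟩
  have hdn : d ≤ Fintype.card α :=
    le_card_of_two_mul_sq_le d S₀ (h𝒮 S₀ hS₀).1 (h𝒮 S₀ hS₀).2
  set bad : Finset (α → Fin c) :=
    𝒮.biUnion fun S => univ.filter fun h => ∀ e ∈ S, (e.map h).IsDiag with hbad
  have hbadcard : #bad < #(univ : Finset (α → Fin c)) := by
    calc #bad ≤ #𝒮 * c ^ (Fintype.card α - d) :=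
          Finset.card_biUnion_le_card_mul _ _ _ fun S hS =>
            card_filter_mono_le hc d S (h𝒮 S hS).1 (h𝒮 S hS).2
      _ < c ^ d * c ^ (Fintype.card α - d) :=
          Nat.mul_lt_mul_of_pos_right hcard (Nat.pow_pos (by omega))
      _ = #(univ : Finset (α → Fin c)) := by
          rw [← pow_add, Nat.add_sub_cancel' hdn, Finset.card_univ, Fintype.card_fun,
            Fintype.card_fin]
  obtain ⟨h, -, hh⟩ := Finset.exists_mem_notMem_of_card_lt_card hbadcard
  refine ⟨h, fun S hS => ?_⟩
  by_contra hno
  push Not at hno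
  exact hh (Finset.mem_biUnion.2 ⟨S, hS, Finset.mem_filter.2 ⟨Finset.mem_univ _, hno⟩⟩)

end Fintype

/-! ### Pigeonhole: a large monochromatic set -/

omit [DecidableEq α] in
/-- Some colour class of a colouring with `c ≥ 1` colours contains a subset of `V` with exactly
`#V / c` elements. [folklore] -/
theorem exists_mono_subset {c : ℕ} (hc : 1 ≤ c) (V : Finset α) (h : α → Fin c) :
    ∃ (k : Fin c) (W : Finset α), W ⊆ V ∧ #W = #V / c ∧ ∀ v ∈ W, h v = k := by
  have : NeZero c := ⟨by omega⟩
  obtain ⟨k, -, hk⟩ := Finset.exists_le_card_fiber_of_mul_le_card_of_maps_to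
    (s := V) (t := (univ : Finset (Fin c))) (f := h) (n := #V / c)
    (fun _ _ => Finset.mem_univ _) Finset.univ_nonempty
    (by rw [Finset.card_univ, Fintype.card_fin]; exact Nat.mul_div_le _ _)
  obtain ⟨W, hW, hWcard⟩ := Finset.exists_subset_card_eq hk
  refine ⟨k, W, hW.trans (Finset.filter_subset _ _), hWcard, fun v hv => ?_⟩
  exact (Finset.mem_filter.1 (hW hv)).2

/-! ### Subsets containing a fixed set -/

/-- The `q`-subsets of `V` containing a fixed set `X` number at most
`(#V - #X).choose (q - #X)`: equality for `X ⊆ V` is Mathlib's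
`Finset.card_filter_powersetCard_subset` (Jukna 2012, Thm 9.26, Case 1: "only
`(n-r choose b-r)` of `b`-cliques can contain" a fixed `r`-set), and the family is empty
otherwise. [cite: Jukna2012, Thm. 9.26] -/
theorem card_filter_supset_powersetCard_le (V X : Finset α) {q : ℕ} (hXq : #X ≤ q) :
    #((V.powersetCard q).filter fun Q => X ⊆ Q) ≤ (#V - #X).choose (q - #X) := by
  by_cases hXV : X ⊆ V
  · exact (Finset.card_filter_powersetCard_subset X V q hXV hXq).le
  · rw [Finset.filter_false_of_mem, Finset.card_empty]
    · exact Nat.zero_le _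
    · intro Q hQ hXQ
      exact hXV (hXQ.trans (Finset.mem_powersetCard.1 hQ).1)

/-- Descending factorials compare like powers: `q(q-1)⋯(q-v+1) · n^v ≤ n(n-1)⋯(n-v+1) · q^v`
for `q ≤ n`. [folklore] -/
theorem descFactorial_mul_pow_le {q n : ℕ} (hqn : q ≤ n) :
    ∀ v : ℕ, q.descFactorial v * n ^ v ≤ n.descFactorial v * q ^ v
  | 0 => by simp
  | v + 1 => by
    have ih := descFactorial_mul_pow_le hqn v
    have hstep : (q - v) * n ≤ (n - v) * q := by
      rcases le_or_gt v q with hv | hv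
      · rw [Nat.sub_mul, Nat.sub_mul, Nat.mul_comm q n]
        exact Nat.sub_le_sub_left (Nat.mul_le_mul_left v hqn) _
      · rw [Nat.sub_eq_zero_of_le hv.le, Nat.zero_mul]
        exact Nat.zero_le _
    calc q.descFactorial (v + 1) * n ^ (v + 1)
        = ((q - v) * n) * (q.descFactorial v * n ^ v) := by rw [Nat.descFactorial_succ]; ring
      _ ≤ ((n - v) * q) * (n.descFactorial v * q ^ v) := Nat.mul_le_mul hstep ih
      _ = n.descFactorial (v + 1) * q ^ (v + 1) := by rw [Nat.descFactorial_succ]; ring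

/-- Binomial coefficients compare like powers: `(q choose v) · n^v ≤ (n choose v) · q^v` for
`q ≤ n`. [folklore] -/
theorem choose_mul_pow_le_choose_mul_pow {q n : ℕ} (hqn : q ≤ n) (v : ℕ) :
    q.choose v * n ^ v ≤ n.choose v * q ^ v := by
  have h := descFactorial_mul_pow_le hqn v
  rw [Nat.descFactorial_eq_factorial_mul_choose, Nat.descFactorial_eq_factorial_mul_choose,
    Nat.mul_assoc, Nat.mul_assoc] at h
  exact Nat.le_of_mul_le_mul_left h (Nat.factorial_pos v)

/-- **Few `q`-sets contain a fixed `v`-set** (Jukna 2012, Thm 9.26, Case 1, "`(n-r choose b-r)`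
of the `b`-cliques"): if `q c ≤ n`, `v ≤ q` and `c ≥ 1`, then
`(n - v).choose (q - v) · c ^ v ≤ n.choose q`. [cite: Jukna2012, Thm. 9.26] -/
theorem choose_sub_mul_pow_le {n q v c : ℕ} (hc : 1 ≤ c) (hv : v ≤ q) (hqc : q * c ≤ n) :
    (n - v).choose (q - v) * c ^ v ≤ n.choose q := by
  have hqn : q ≤ n := (Nat.le_mul_of_pos_right q hc).trans hqc
  have hvn : v ≤ n := hv.trans hqn
  rcases Nat.eq_zero_or_pos q with rfl | hq
  · obtain rfl : v = 0 := Nat.le_zero.1 hv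
    simp
  -- `C(n,q) C(q,v) = C(n,v) C(n-v,q-v)` and `C(q,v) n^v ≤ C(n,v) q^v`
  have h1 : n.choose q * q.choose v = n.choose v * (n - v).choose (q - v) := Nat.choose_mul hv
  have h2 := choose_mul_pow_le_choose_mul_pow hqn v
  have h3 : (n - v).choose (q - v) * n ^ v * n.choose v ≤ n.choose q * q ^ v * n.choose v := by
    calc (n - v).choose (q - v) * n ^ v * n.choose v
        = (n.choose q * q.choose v) * n ^ v := by rw [h1]; ring
      _ = n.choose q * (q.choose v * n ^ v) := by ring
      _ ≤ n.choose q * (n.choose v * q ^ v) := Nat.mul_le_mul_left _ h2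
      _ = n.choose q * q ^ v * n.choose v := by ring
  have h4 : (n - v).choose (q - v) * n ^ v ≤ n.choose q * q ^ v :=
    Nat.le_of_mul_le_mul_right h3 (Nat.choose_pos hvn)
  have h5 : (n - v).choose (q - v) * c ^ v * q ^ v ≤ n.choose q * q ^ v := by
    calc (n - v).choose (q - v) * c ^ v * q ^ v = (n - v).choose (q - v) * (q * c) ^ v := by
          rw [Nat.mul_pow]; ring
      _ ≤ (n - v).choose (q - v) * n ^ v := Nat.mul_le_mul_left _ (Nat.pow_le_pow_left hqc v)
      _ ≤ n.choose q * q ^ v := h4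
  exact Nat.le_of_mul_le_mul_right h5 (Nat.pow_pos hq)

/-! ### A good clique exists -/

/-- **A good clique exists** (Jukna 2012, Thm 9.26, Case 1, union bound, in the form needed for
Amano–Maruoka): let `q c ≤ #V`, `2 ≤ q`, `d ≤ q`, `c ≥ 1`; if a family `𝒟` of edge sets, each
with more than `(d choose 2)` edges, and a set `I` of non-loop edges satisfy `4 |𝒟| ≤ c ^ d`
and `4 |I| ≤ c ^ 2`, then some `q`-subset `Q ⊆ V` spans a clique containing no member of `𝒟`
and no edge of `I`. [cite: Jukna2012, Thm. 9.26] -/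
theorem exists_good_clique (V : Finset α) {q c d : ℕ} (hc : 1 ≤ c) (hqc : q * c ≤ #V)
    (hdq : d ≤ q) (h2q : 2 ≤ q) (𝒟 : Finset (Finset (Sym2 α)))
    (h𝒟 : ∀ P ∈ 𝒟, d.choose 2 < #P) (I : Finset (Sym2 α)) (hI : ∀ e ∈ I, ¬ e.IsDiag)
    (hD4 : 4 * #𝒟 ≤ c ^ d) (hI4 : 4 * #I ≤ c ^ 2) :
    ∃ Q ⊆ V, #Q = q ∧ (∀ P ∈ 𝒟, ∃ e ∈ P, ∃ v ∈ e, v ∉ Q) ∧ ∀ e ∈ I, ∃ v ∈ e, v ∉ Q := by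
  classical
  set n := #V with hn
  have hqn : q ≤ n := (Nat.le_mul_of_pos_right q hc).trans hqc
  set all := V.powersetCard q with hall
  have hallcard : #all = n.choose q := by rw [hall, Finset.card_powersetCard]
  have hallpos : 0 < n.choose q := Nat.choose_pos hqn
  -- cliques containing a member of `𝒟`
  set badD : Finset (Finset α) :=
    𝒟.biUnion fun P => all.filter fun Q => ∀ e ∈ P, ∀ v ∈ e, v ∈ Q with hbadD
  have hbadD4 : 4 * #badD ≤ n.choose q := by
    have h1 : #badD ≤ #𝒟 * (n - d).choose (q - d) := by
      refine Finset.card_biUnion_le_card_mul _ _ _ fun P hP => ?_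
      obtain ⟨X, hX, hXcard⟩ := Finset.exists_subset_card_eq (le_card_edgeVerts (h𝒟 P hP))
      calc #(all.filter fun Q => ∀ e ∈ P, ∀ v ∈ e, v ∈ Q)
          ≤ #(all.filter fun Q => X ⊆ Q) :=
            Finset.card_le_card (Finset.monotone_filter_right _ fun Q _ hQ =>
              hX.trans (edgeVerts_subset hQ))
        _ ≤ (n - #X).choose (q - #X) := card_filter_supset_powersetCard_le V X (hXcard ▸ hdq)
        _ = (n - d).choose (q - d) := by rw [hXcard]
    calc 4 * #badD ≤ 4 * (#𝒟 * (n - d).choose (q - d)) := Nat.mul_le_mul_left 4 h1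
      _ = (n - d).choose (q - d) * (4 * #𝒟) := by ring
      _ ≤ (n - d).choose (q - d) * c ^ d := Nat.mul_le_mul_left _ hD4
      _ ≤ n.choose q := choose_sub_mul_pow_le hc hdq hqc
  -- cliques containing an edge of `I`
  set badI : Finset (Finset α) := I.biUnion fun e => all.filter fun Q => ∀ v ∈ e, v ∈ Q
    with hbadI
  have hbadI4 : 4 * #badI ≤ n.choose q := by
    have h1 : #badI ≤ #I * (n - 2).choose (q - 2) := by
      refine Finset.card_biUnion_le_card_mul _ _ _ fun e he => ?_
      induction e using Sym2.ind with
      | _ x y =>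
        have hxy : x ≠ y := fun h => hI _ he (by simp [h])
        have hX : #({x, y} : Finset α) = 2 := Finset.card_pair hxy
        calc #(all.filter fun Q => ∀ v ∈ s(x, y), v ∈ Q)
            ≤ #(all.filter fun Q => ({x, y} : Finset α) ⊆ Q) :=
              Finset.card_le_card (Finset.monotone_filter_right _ fun Q _ hQ => by
                rw [Finset.insert_subset_iff, Finset.singleton_subset_iff]
                exact ⟨hQ x (Sym2.mem_mk_left x y), hQ y (Sym2.mem_mk_right x y)⟩)
          _ ≤ (n - #({x, y} : Finset α)).choose (q - #({x, y} : Finset α)) :=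
              card_filter_supset_powersetCard_le V {x, y} (by rw [hX]; exact h2q)
          _ = (n - 2).choose (q - 2) := by rw [hX]
    calc 4 * #badI ≤ 4 * (#I * (n - 2).choose (q - 2)) := Nat.mul_le_mul_left 4 h1
      _ = (n - 2).choose (q - 2) * (4 * #I) := by ring
      _ ≤ (n - 2).choose (q - 2) * c ^ 2 := Nat.mul_le_mul_left _ hI4
      _ ≤ n.choose q := choose_sub_mul_pow_le hc h2q hqc
  -- a good clique
  have hlt : #(badD ∪ badI) < #all := by
    rw [hallcard]
    have := Finset.card_union_le badD badI
    omega
  obtain ⟨Q, hQall, hQbad⟩ := Finset.exists_mem_notMem_of_card_lt_card hlt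
  rw [Finset.mem_union, not_or] at hQbad
  rw [hall, Finset.mem_powersetCard] at hQall
  refine ⟨Q, hQall.1, hQall.2, fun P hP => ?_, fun e he => ?_⟩
  · by_contra hno
    push Not at hno
    exact hQbad.1 (Finset.mem_biUnion.2 ⟨P, hP, Finset.mem_filter.2
      ⟨Finset.mem_powersetCard.2 hQall, hno⟩⟩)
  · by_contra hno
    push Not at hno
    exact hQbad.2 (Finset.mem_biUnion.2 ⟨e, he, Finset.mem_filter.2
      ⟨Finset.mem_powersetCard.2 hQall, hno⟩⟩)

end Literature.Computability.Complexity
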